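import Mathlib.NumberTheory.LSeries.Convolution
import Mathlib.NumberTheory.LSeries.Dirichlet
import Mathlib.NumberTheory.LSeries.Linearity
import Mathlib.NumberTheory.ArithmeticFunction.Moebius
import Mathlib.NumberTheory.ZetaValues
import Mathlib.Analysis.Real.Pi.Bounds
import HarnessLib

/-!
# RH-EQUIVALENT·SPLITTING CENSUS (nb, neg) · V36 part C «MÖBIUS LOCK, ALL INDICES» (file 1 of 2: the Dirichlet-series engine): effective uniqueness of Dirichlet coefficients under a linear budget, and Möbius inversion with errors — pure Mathlib lemmas feeding the zero-free lock `a_j → μ(j+1)` of every coefficient of a budgeted Nyman–Beurling approximant (file 2, `Splittings.NbMoebiusLockSign`); nothing here bears on the truth of RH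

LABEL (line 1): RH-EQUIVALENT·SPLITTING (cell `rh-split`, seat (nb, neg), generation 11, census
candidate V36, part C, file 1 of 2).  FILE NOTE: this file holds Parts 1–2 (no `ζ`-integral, no
route object: Dirichlet series only); Parts 3–4 — the Nyman–Beurling lock `nbMoebiusLock` and the
refuted conjuncts (SIGN LAW, VANISHING LAW) — are in `Splittings.NbMoebiusLockSign`, which re-opens
this namespace.  Zero definitions; standard axioms; imports Mathlib leaves + HarnessLib only.

## Results (this file)

* `dirichletCoeff_small_of_lseries_small` — EFFECTIVE UNIQUENESS OF DIRICHLET COEFFICIENTS under a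
  linear budget: if `‖g m‖ ≤ C·m` for all `m` and `‖L g(k)‖ ≤ e·B(k)` at all natural points `k ≥ 4`,
  then for every `n` and `η > 0` some `e > 0` depending on `(n, C, B, η)` ONLY forces
  `‖g m‖ ≤ η ∀ m ≤ n` (induction on `n`: `g(n) = n^k (L g(k) - Σ_{m<n} g(m) m^{-k} - tail)` with
  `‖tail·n^k‖ ≤ 2C(n+1)³(n/(n+1))^k` (`norm_tsum_term_shift_le_of_linear`, via `Σ 1/m² = π²/6`),
  `k` chosen first with `(n/(n+1))^k` small, then the smallness of the lower coefficients).
* `norm_coe_zeta_mul_toArithmeticFunction_le`: `‖(ζ * F)(n)‖ ≤ M·n` when `‖F‖ ≤ M` (`d(n) ≤ n`).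
* `lseries_coe_zeta_mul_sub_delta`: `L(ζ * F - δ)(k) = ζ(k)·L F(k) - 1` for bounded `F`, `k ≥ 2`
  (Mathlib `LSeries_mul'`, `LSeries_zeta_eq_riemannZeta`, `LSeries_delta`).
* `norm_sub_moebius_le` — MÖBIUS INVERSION WITH ERRORS: if `‖(ζ * F)(e) - δ(e)‖ ≤ η` for all
  `e ≤ n` then `‖F(n) - μ(n)‖ ≤ n·η` (`coe_moebius_mul_coe_zeta`, `|μ| ≤ 1`, `#divisors n ≤ n`).

HONEST LABEL: «SPLITTING SEARCH over kernel-typed RH-EQUIVALENCES; a splitting A ∧ B ⟹ RH is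
CONDITIONAL bookkeeping unless A and B are both proved; nothing here bears on the truth of RH.»
-/

set_option linter.dupNamespace false

noncomputable section

open Complex Filter Topology Finset
open scoped Real ArithmeticFunction.Moebius ArithmeticFunction.zeta

namespace Summit.RiemannHypothesis.RiemannHypothesis.Theorems.Splittings.NbMoebiusLock

/-! ## Part 1: effective uniqueness of Dirichlet coefficients under a linear budget -/

/-- The `m`-th L-series term at a natural point `k`: norm. -/
theorem norm_term_natCast (g : ℕ → ℂ) (k : ℕ) {m : ℕ} (hm : m ≠ 0) :
    ‖LSeries.term g (k : ℂ) m‖ = ‖g m‖ / (m : ℝ) ^ k := by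
  rw [LSeries.term_of_ne_zero hm, norm_div, Complex.cpow_natCast, norm_pow, Complex.norm_natCast]

/-- Summability of `L g` at a natural point `k ≥ 4` under a linear coefficient budget. -/
theorem lseriesSummable_of_linear {g : ℕ → ℂ} {C : ℝ} (hC : ∀ m, ‖g m‖ ≤ C * m) {k : ℕ}
    (hk : 4 ≤ k) : LSeriesSummable g (k : ℂ) := by
  refine LSeriesSummable_of_le_const_mul_rpow (x := 2) (by simp; exact_mod_cast (by omega : 2 < k))
    ⟨C, fun n _ ↦ ?_⟩
  norm_num
  exact hC n

/-- Tail bound: under `‖g m‖ ≤ C m`, `‖Σ' m, term g k (m + (N+1))‖ ≤ 2C/(N+1)^(k-3)` (`k ≥ 4`;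
via `Σ 1/(m+1)² = π²/6 ≤ 2`). -/
theorem norm_tsum_term_shift_le_of_linear {g : ℕ → ℂ} {C : ℝ} (hC : ∀ m, ‖g m‖ ≤ C * m) {k : ℕ}
    (hk : 4 ≤ k) (N : ℕ) :
    ‖∑' m : ℕ, LSeries.term g (k : ℂ) (m + (N + 1))‖ ≤ 2 * C / ((N : ℝ) + 1) ^ (k - 3) := by
  have hζ2 : HasSum (fun m : ℕ ↦ 1 / ((m : ℝ) + 1) ^ 2) (π ^ 2 / 6) := by
    have h := (hasSum_nat_add_iff' 1).mpr hasSum_zeta_two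
    simp only [sum_range_one, Nat.cast_zero, ne_eq, OfNat.ofNat_ne_zero, not_false_eq_true,
      zero_pow, div_zero, sub_zero, Nat.cast_add, Nat.cast_one] at h
    exact h
  have hC0 : 0 ≤ C := by
    have h := hC 1; simp at h; exact (norm_nonneg _).trans h
  have hN1 : (0 : ℝ) < (N : ℝ) + 1 := by positivity
  have hmaj : ∀ m : ℕ, ‖LSeries.term g (k : ℂ) (m + (N + 1))‖ ≤
      C / ((N : ℝ) + 1) ^ (k - 3) * (1 / ((m : ℝ) + 1) ^ 2) := by
    intro m
    have hm0 : m + (N + 1) ≠ 0 := by omega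
    rw [norm_term_natCast g k hm0]
    have hx1 : (1 : ℝ) ≤ ((m + (N + 1) : ℕ) : ℝ) := by exact_mod_cast (by omega : 1 ≤ m + (N + 1))
    have hx0 : (0 : ℝ) < ((m + (N + 1) : ℕ) : ℝ) := by linarith
    set x : ℝ := ((m + (N + 1) : ℕ) : ℝ) with hxdef
    have hxN : (N : ℝ) + 1 ≤ x := by
      rw [hxdef]; push_cast; linarith [(Nat.cast_nonneg m : (0:ℝ) ≤ m)]
    have hxm : (m : ℝ) + 1 ≤ x := by
      rw [hxdef]; push_cast; linarith [(Nat.cast_nonneg N : (0:ℝ) ≤ N)]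
    have hsplit : x ^ k = x * (x ^ (k - 3) * x ^ 2) := by
      rw [← pow_add, ← pow_succ']; congr 1; omega
    calc ‖g (m + (N + 1))‖ / x ^ k ≤ C * x / x ^ k :=
          div_le_div_of_nonneg_right (hC _) (by positivity)
      _ = C / (x ^ (k - 3) * x ^ 2) := by
          rw [hsplit, mul_comm C x, mul_div_mul_left _ _ hx0.ne']
      _ ≤ C / (((N : ℝ) + 1) ^ (k - 3) * ((m : ℝ) + 1) ^ 2) := by
          apply div_le_div_of_nonneg_left hC0 (by positivity)
          exact mul_le_mul (pow_le_pow_left₀ hN1.le hxN _) (pow_le_pow_left₀ (by positivity) hxm _)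
            (by positivity) (by positivity)
      _ = C / ((N : ℝ) + 1) ^ (k - 3) * (1 / ((m : ℝ) + 1) ^ 2) := by
          field_simp
  have hsum : HasSum (fun m : ℕ ↦ C / ((N : ℝ) + 1) ^ (k - 3) * (1 / ((m : ℝ) + 1) ^ 2))
      (C / ((N : ℝ) + 1) ^ (k - 3) * (π ^ 2 / 6)) := hζ2.mul_left _
  refine (tsum_of_norm_bounded hsum hmaj).trans ?_
  have hpi : π ^ 2 / 6 ≤ 2 := by
    have h1 := Real.pi_lt_d2
    have h2 := mul_lt_mul'' h1 h1 Real.pi_pos.le Real.pi_pos.le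
    nlinarith
  have h0 : 0 ≤ C / ((N : ℝ) + 1) ^ (k - 3) := by positivity
  calc C / ((N : ℝ) + 1) ^ (k - 3) * (π ^ 2 / 6) ≤ C / ((N : ℝ) + 1) ^ (k - 3) * 2 :=
        mul_le_mul_of_nonneg_left hpi h0
    _ = 2 * C / ((N : ℝ) + 1) ^ (k - 3) := by ring

/-- **Effective uniqueness of Dirichlet coefficients under a linear budget (qualitative-uniform
form).**  If `‖g m‖ ≤ C·m` and `‖L g (k)‖ ≤ e·B(k)` at every natural point `k ≥ 4`, then the first
`n` coefficients are small, uniformly: for every `η > 0` some `e > 0` works for ALL such `g`. -/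
theorem dirichletCoeff_small_of_lseries_small (n : ℕ) :
    ∀ (C : ℝ) (B : ℕ → ℝ) (η : ℝ), (∀ k, 0 ≤ B k) → 0 < η →
      ∃ e : ℝ, 0 < e ∧ ∀ g : ℕ → ℂ, (∀ m, ‖g m‖ ≤ C * m) →
        (∀ k : ℕ, 4 ≤ k → ‖LSeries g (k : ℂ)‖ ≤ e * B k) → ∀ m, m ≤ n → ‖g m‖ ≤ η := by
  induction n with
  | zero =>
    intro C B η hB hη
    refine ⟨1, one_pos, fun g hC _ m hm ↦ ?_⟩
    obtain rfl : m = 0 := Nat.le_zero.mp hm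
    have h := hC 0
    simp at h
    rw [h]; simp; exact hη.le
  | succ n ih =>
    intro C B η hB hη
    -- the budget constant is nonnegative as soon as some `g` satisfies it; we may assume `0 ≤ C`
    by_cases hC0 : 0 ≤ C
    swap
    · refine ⟨1, one_pos, fun g hC _ m _ ↦ ?_⟩
      exfalso
      have h := (norm_nonneg _).trans (hC 1)
      simp at h
      exact hC0 h
    set N : ℕ := n + 1 with hNdef
    have hN0 : (0 : ℝ) < (N : ℝ) := by positivity
    -- evaluation point
    set ρ : ℝ := (N : ℝ) / ((N : ℝ) + 1) with hρdef
    have hρ0 : 0 < ρ := by positivity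
    have hρ1 : ρ < 1 := by rw [hρdef, div_lt_one (by positivity)]; linarith
    set D : ℝ := 2 * C * ((N : ℝ) + 1) ^ 3 + 1 with hDdef
    have hD0 : 0 < D := by positivity
    obtain ⟨k₀, hk₀⟩ := exists_pow_lt_of_lt_one (show 0 < η / (3 * D) by positivity) hρ1
    set k : ℕ := max k₀ 4 with hkdef
    have hk4 : 4 ≤ k := le_max_right _ _
    have hρk : ρ ^ k ≤ ρ ^ k₀ := pow_le_pow_of_le_one hρ0.le hρ1.le (le_max_left _ _)
    -- accuracy for the lower coefficients
    set η' : ℝ := η / (3 * (N : ℝ) ^ (k + 1)) with hη'def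
    have hη'0 : 0 < η' := by positivity
    have hNk1 : (1 : ℝ) ≤ (N : ℝ) ^ (k + 1) := one_le_pow₀ (by exact_mod_cast (by omega : 1 ≤ N))
    have hη'η : η' ≤ η := by
      rw [hη'def, div_le_iff₀ (by positivity)]; nlinarith
    obtain ⟨e₁, he₁, h₁⟩ := ih C B η' hB hη'0
    set e : ℝ := min e₁ (η / (3 * ((N : ℝ) ^ k * (B k + 1)))) with hedef
    have hBk : 0 < B k + 1 := by linarith [hB k]
    have he0 : 0 < e := lt_min he₁ (by positivity)
    refine ⟨e, he0, fun g hC hL m hm ↦ ?_⟩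
    -- the lower coefficients
    have hlow : ∀ m, m ≤ n → ‖g m‖ ≤ η' := by
      refine h₁ g hC (fun k' hk' ↦ (hL k' hk').trans ?_)
      exact mul_le_mul_of_nonneg_right (min_le_left _ _) (hB k')
    rcases Nat.lt_or_ge m N with hmN | hmN
    · exact (hlow m (by omega)).trans hη'η
    obtain rfl : m = N := le_antisymm hm hmN
    -- the top coefficient: split `L g k = S + g N / N^k + T`
    have hs : LSeriesSummable g (k : ℂ) := lseriesSummable_of_linear hC hk4
    have hsplit := hs.sum_add_tsum_nat_add (N + 1)
    rw [Finset.sum_range_succ] at hsplit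
    set S := ∑ m ∈ Finset.range N, LSeries.term g (k : ℂ) m with hSdef
    set T := ∑' m : ℕ, LSeries.term g (k : ℂ) (m + (N + 1)) with hTdef
    have hNne : (N : ℕ) ≠ 0 := by omega
    have htermN : LSeries.term g (k : ℂ) N = g N / (N : ℂ) ^ k := by
      rw [LSeries.term_of_ne_zero hNne, Complex.cpow_natCast]
    rw [htermN] at hsplit
    -- norms
    have hS : ‖S‖ ≤ (N : ℝ) * η' := by
      calc ‖S‖ ≤ ∑ m ∈ Finset.range N, ‖LSeries.term g (k : ℂ) m‖ := norm_sum_le _ _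
        _ ≤ ∑ m ∈ Finset.range N, η' := by
            refine Finset.sum_le_sum fun m hm ↦ ?_
            rw [Finset.mem_range] at hm
            rcases eq_or_ne m 0 with rfl | hm0
            · simp [LSeries.term]; exact hη'0.le
            rw [norm_term_natCast g k hm0]
            have hm1 : (1 : ℝ) ≤ (m : ℝ) ^ k :=
              one_le_pow₀ (by exact_mod_cast Nat.one_le_iff_ne_zero.mpr hm0)
            exact (div_le_self (norm_nonneg _) hm1).trans (hlow m (by omega))
        _ = (N : ℝ) * η' := by simp
    have hT : ‖T‖ ≤ 2 * C / ((N : ℝ) + 1) ^ (k - 3) := norm_tsum_term_shift_le_of_linear hC hk4 N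
    have hLk : ‖LSeries g (k : ℂ)‖ ≤ e * B k := hL k hk4
    -- isolate g N
    have hL' : LSeries g (k : ℂ) = S + g N / (N : ℂ) ^ k + T := hsplit.symm
    have hgN : g N = (N : ℂ) ^ k * (LSeries g (k : ℂ) - S - T) := by
      have hNc : (N : ℂ) ^ k ≠ 0 := pow_ne_zero _ (by exact_mod_cast hNne)
      rw [hL']; field_simp; ring
    have hnorm :
        ‖g N‖ ≤ (N : ℝ) ^ k * (e * B k + (N : ℝ) * η' + 2 * C / ((N : ℝ) + 1) ^ (k - 3)) := by
      rw [hgN, norm_mul, norm_pow, Complex.norm_natCast]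
      refine mul_le_mul_of_nonneg_left ?_ (by positivity)
      calc ‖LSeries g (k : ℂ) - S - T‖ ≤ ‖LSeries g (k : ℂ)‖ + ‖S‖ + ‖T‖ := by
            calc _ ≤ ‖LSeries g (k : ℂ) - S‖ + ‖T‖ := norm_sub_le _ _
              _ ≤ _ := by gcongr; exact norm_sub_le _ _
        _ ≤ _ := by linarith
    -- the three thirds
    have h1 : (N : ℝ) ^ k * (e * B k) ≤ η / 3 := by
      have he : e ≤ η / (3 * ((N : ℝ) ^ k * (B k + 1))) := min_le_right _ _
      have hNk : (0 : ℝ) < (N : ℝ) ^ k := by positivity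
      calc (N : ℝ) ^ k * (e * B k)
          ≤ (N : ℝ) ^ k * (η / (3 * ((N : ℝ) ^ k * (B k + 1))) * (B k + 1)) := by
            refine mul_le_mul_of_nonneg_left ?_ hNk.le
            exact mul_le_mul he (by linarith) (hB k) (by positivity)
        _ = η / 3 := by field_simp
    have h2 : (N : ℝ) ^ k * ((N : ℝ) * η') = η / 3 := by
      rw [hη'def, pow_succ]; field_simp
    have h3 : (N : ℝ) ^ k * (2 * C / ((N : ℝ) + 1) ^ (k - 3)) ≤ η / 3 := by
      have hpow : ((N : ℝ) + 1) ^ k = ((N : ℝ) + 1) ^ (k - 3) * ((N : ℝ) + 1) ^ 3 := by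
        rw [← pow_add]; congr 1; omega
      have e3 : (N : ℝ) ^ k * (2 * C / ((N : ℝ) + 1) ^ (k - 3)) =
          2 * C * ((N : ℝ) + 1) ^ 3 * ρ ^ k := by
        rw [hρdef, div_pow, hpow]
        field_simp
      rw [e3]
      have hlt : ρ ^ k₀ * (3 * D) < η := by rwa [lt_div_iff₀ (by positivity)] at hk₀
      have s1 : 2 * C * ((N : ℝ) + 1) ^ 3 * ρ ^ k ≤ D * ρ ^ k :=
        mul_le_mul_of_nonneg_right (by rw [hDdef]; linarith) (by positivity)
      have s2 : D * ρ ^ k ≤ D * ρ ^ k₀ := mul_le_mul_of_nonneg_left hρk hD0.le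
      have s3 : D * ρ ^ k₀ = ρ ^ k₀ * (3 * D) / 3 := by ring
      linarith
    calc ‖g N‖ ≤ _ := hnorm
      _ = (N : ℝ) ^ k * (e * B k) + (N : ℝ) ^ k * ((N : ℝ) * η') +
            (N : ℝ) ^ k * (2 * C / ((N : ℝ) + 1) ^ (k - 3)) := by ring
      _ ≤ η / 3 + η / 3 + η / 3 := by rw [h2]; linarith
      _ = η := by ring

/-! ## Part 2: Dirichlet polynomials as L-series, convolution with `ζ`, Möbius inversion -/

open ArithmeticFunction in
/-- Divisor-sum budget: if `‖F n‖ ≤ M` for all `n`, then `‖(ζ * F)(n)‖ ≤ M·n`. -/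
theorem norm_coe_zeta_mul_toArithmeticFunction_le {F : ℕ → ℂ} {M : ℝ} (hM0 : 0 ≤ M)
    (hM : ∀ n, ‖F n‖ ≤ M) (n : ℕ) :
    ‖((ζ : ArithmeticFunction ℂ) * toArithmeticFunction F) n‖ ≤ M * n := by
  rw [coe_zeta_mul_apply]
  have hF : ∀ i, ‖toArithmeticFunction F i‖ ≤ M := by
    intro i
    show ‖(if i = 0 then 0 else F i)‖ ≤ M
    split_ifs
    · simpa using hM0
    · exact hM i
  calc ‖∑ i ∈ n.divisors, toArithmeticFunction F i‖
      ≤ ∑ i ∈ n.divisors, ‖toArithmeticFunction F i‖ := norm_sum_le _ _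
    _ ≤ ∑ i ∈ n.divisors, M := Finset.sum_le_sum fun i _ ↦ hF i
    _ = (n.divisors.card : ℝ) * M := by simp
    _ ≤ (n : ℝ) * M := by
        exact mul_le_mul_of_nonneg_right (by exact_mod_cast Nat.card_divisors_le_self n) hM0
    _ = M * n := mul_comm _ _

open ArithmeticFunction in
/-- The L-series of `ζ * F - δ` at a natural point `k ≥ 2` is `ζ(k)·L F(k) - 1` (bounded `F`). -/
theorem lseries_coe_zeta_mul_sub_delta {F : ℕ → ℂ} {M : ℝ} (hM : ∀ n, ‖F n‖ ≤ M) {k : ℕ}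
    (hk : 2 ≤ k) :
    LSeries (fun n ↦ ((ζ : ArithmeticFunction ℂ) * toArithmeticFunction F) n - LSeries.delta n)
      (k : ℂ) = riemannZeta k * LSeries F k - 1 := by
  have hkre : 1 < (k : ℂ).re := by simp; omega
  have hζs : LSeriesSummable (fun n ↦ ((ζ : ArithmeticFunction ℂ) n : ℂ)) (k : ℂ) := by
    have h := LSeriesSummable_zeta_iff.mpr hkre
    refine (LSeriesSummable_congr (k : ℂ) fun {n} _ ↦ ?_).mp h
    simp [natCoe_apply]
  have hΦs : LSeriesSummable (fun n ↦ (toArithmeticFunction F n : ℂ)) (k : ℂ) := by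
    refine LSeriesSummable_of_bounded_of_one_lt_re (m := M) (fun n hn ↦ ?_) hkre
    show ‖(if n = 0 then 0 else F n)‖ ≤ M
    rw [if_neg hn]; exact hM n
  have hprod : LSeriesSummable
      (fun n ↦ (((ζ : ArithmeticFunction ℂ) * toArithmeticFunction F) n : ℂ)) (k : ℂ) :=
    ArithmeticFunction.LSeriesSummable_mul hζs hΦs
  have hδs : LSeriesSummable LSeries.delta (k : ℂ) :=
    LSeriesSummable_of_bounded_of_one_lt_re (m := 1) (fun n _ ↦ by
      simp only [LSeries.delta]; split_ifs <;> simp) hkre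
  have hsub := LSeries_sub hprod hδs
  have e1 : (fun n ↦ ((ζ : ArithmeticFunction ℂ) * toArithmeticFunction F) n - LSeries.delta n) =
      (fun n ↦ (((ζ : ArithmeticFunction ℂ) * toArithmeticFunction F) n : ℂ)) - LSeries.delta := by
    funext n; simp
  rw [e1, hsub, ArithmeticFunction.LSeries_mul' hζs hΦs]
  have hζ : LSeries (fun n ↦ ((ζ : ArithmeticFunction ℂ) n : ℂ)) (k : ℂ) = riemannZeta k := by
    rw [← LSeries_zeta_eq_riemannZeta hkre]
    refine LSeries_congr (fun {n} _ ↦ ?_) _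
    simp [natCoe_apply]
  have hΦ : LSeries (fun n ↦ (toArithmeticFunction F n : ℂ)) (k : ℂ) = LSeries F k := by
    refine LSeries_congr (fun {n} hn ↦ ?_) _
    show (if n = 0 then 0 else F n) = F n
    rw [if_neg hn]
  have hδ : LSeries LSeries.delta (k : ℂ) = 1 := by
    have := congrFun LSeries_delta (k : ℂ); simpa using this
  rw [hζ, hΦ, hδ]

open ArithmeticFunction in
/-- **Möbius inversion with errors.** If the divisor sums `(ζ * F)(e)` are within `η` of `δ(e)` for
all `e ≤ n`, then `F(n)` is within `n·η` of `μ(n)`. -/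
theorem norm_sub_moebius_le {F : ℕ → ℂ} {η : ℝ} {n : ℕ} (hn : n ≠ 0)
    (h : ∀ e, e ≤ n →
      ‖((ζ : ArithmeticFunction ℂ) * toArithmeticFunction F) e - LSeries.delta e‖ ≤ η) :
    ‖F n - (μ n : ℂ)‖ ≤ n * η := by
  set Φ : ArithmeticFunction ℂ := toArithmeticFunction F with hΦ
  set Ψ : ArithmeticFunction ℂ := (ζ : ArithmeticFunction ℂ) * Φ with hΨ
  have hinv : (μ : ArithmeticFunction ℂ) * Ψ = Φ := by
    rw [hΨ, ← mul_assoc, coe_moebius_mul_coe_zeta, one_mul]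
  have hFn : F n = ((μ : ArithmeticFunction ℂ) * Ψ) n := by
    rw [hinv, hΦ]
    show F n = if n = 0 then 0 else F n
    rw [if_neg hn]
  have hμn : (μ n : ℂ) = ((μ : ArithmeticFunction ℂ) * 1) n := by
    rw [mul_one, intCoe_apply]
  have hdiff : F n - (μ n : ℂ) =
      ∑ p ∈ n.divisorsAntidiagonal, (μ p.1 : ℂ) * (Ψ p.2 - LSeries.delta p.2) := by
    rw [hFn, hμn, mul_apply, mul_apply, ← Finset.sum_sub_distrib]
    refine Finset.sum_congr rfl fun p _ ↦ ?_
    rw [intCoe_apply, one_apply, LSeries.delta, mul_sub]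
  rw [hdiff]
  have hη0 : 0 ≤ η := (norm_nonneg _).trans (h 0 (Nat.zero_le _))
  calc ‖∑ p ∈ n.divisorsAntidiagonal, (μ p.1 : ℂ) * (Ψ p.2 - LSeries.delta p.2)‖
      ≤ ∑ p ∈ n.divisorsAntidiagonal, ‖(μ p.1 : ℂ) * (Ψ p.2 - LSeries.delta p.2)‖ := norm_sum_le _ _
    _ ≤ ∑ p ∈ n.divisorsAntidiagonal, η := by
        refine Finset.sum_le_sum fun p hp ↦ ?_
        rw [norm_mul]
        have h1 : ‖(μ p.1 : ℂ)‖ ≤ 1 := by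
          rw [Complex.norm_intCast]
          exact_mod_cast abs_moebius_le_one
        have h2 : ‖Ψ p.2 - LSeries.delta p.2‖ ≤ η :=
          h p.2 (Nat.divisor_le (Nat.snd_mem_divisors_of_mem_antidiagonal hp))
        calc ‖(μ p.1 : ℂ)‖ * ‖Ψ p.2 - LSeries.delta p.2‖ ≤ 1 * η :=
              mul_le_mul h1 h2 (norm_nonneg _) zero_le_one
          _ = η := one_mul η
    _ = (n.divisorsAntidiagonal.card : ℝ) * η := by simp
    _ ≤ n * η := by
        refine mul_le_mul_of_nonneg_right ?_ hη0
        rw [← Nat.map_div_right_divisors, Finset.card_map]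
        exact_mod_cast Nat.card_divisors_le_self n

end Summit.RiemannHypothesis.RiemannHypothesis.Theorems.Splittings.NbMoebiusLock
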